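import Mathlib.MeasureTheory.Integral.Prod
import Literature.MathematicalPhysics.QuantumFieldTheory.LatticeLangevinDynamics

/-!
# Route `TransportPerturbation`, LINE «regular_shadow» (crux K2 stmt-QuantumFields-26987): the AVERAGING STEP behind support item
# `ShadowAveraging` (stmt-QuantumFields-27785) — route-independent core (seat `ym-line-csu-p1` g5, 2026-08-28)

Rung R3 of LADDER-YM is a RECORD rung: no summit, no continuum limit and no mass gap is proved here.  PURE MEASURE THEORY about the
transition operators `markovTransition V P t g x = ∫ g (V x t ω) dP(ω)` of an arbitrary jointly measurable family; no route file is
imported (theses-cone hygiene); assembled BY NAME in `TransportPerturbationShadowAveraging.lean`.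
`shadowAveraging_abstract`: on ANY configuration space with a transport weight `S ≤ 4` positive on one pair, with
`Φg(x) := P'_{t'}(g∘Dc)(E x)`, `Ψg := P_t g`, a regular predicate `R` of co-mass `≤ e`, the pointwise shadowing clause
`|Φg(x) − Ψg(D x)| ≤ A·ρ·√(1 + ΦΛ(x) + ΨΛ(D x))` on `R` for the Hairer–Mattingly–Scheutzow weighted class
`𝒢^Λ(A) = {g measurable, |g| ≤ 1, |g u − g v| ≤ A √(S(u,v)(1 + Λ u + Λ v))}` and the window identity `∫ g∘D dμ = ∫ Φg dμ`:
`|∫ g∘D dμ − ∫ (Ψg)∘D dμ| ≤ A·(ρ + 2√e)·(1 + ∫ Λ∘D dμ + ∫ (ΨΛ)∘D dμ)`.  PROOF (the refuter's sketch on the item, 13:01Z): §1 AM–GM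
`√z ≤ z/(2s) + s/2`, measurability (`StronglyMeasurable.integral_prod_right'`) and bounds of transition operators;
§2 TWO-SPACE OSCILLATION BOUND `|E' g(y₁) − E g(y₂)| ≤ 2A √(1 + E'Λ(y₁) + EΛ(y₂))` from `|g u − g v| ≤ 2A√(1 + Λ u + Λ v)` (iterated
integral + AM–GM at `s = √(1 + E'Λ + EΛ)`, a Jensen-free Jensen); §3 the corner `A < 0` is vacuous (empty class at the separating
pair); window identity; split on `R` (clause on `R`, §2 off `R` via `S ≤ 4`); `∫√Z ≤ ∫Z`; AM–GM Cauchy–Schwarz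
`∫ 1_{¬R}√Z ≤ √(μ(¬R))√(∫Z)` (`s = √(∫Z)/√e`; `e = 0` ⇒ null set); `∫ ΦΛ dμ = ∫ Λ∘D dμ` by the identity for `Λ / max M 1`.
No definitions, no named facts, no `sorry`.  Refs: Hairer–Mattingly–Scheutzow, PTRF **149** (2011) [arXiv:0902.4495] §4 (weighted
distance `√(d(1+V+V))`); Rudolf–Schweizer, Bernoulli **24** (2018) [arXiv:1503.04123] Thm 3.1 (Wasserstein perturbation bounds).
-/

set_option autoImplicit false
noncomputable section
open MeasureTheory
open scoped NNReal
open Literature.MathematicalPhysics.QuantumFieldTheory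

namespace Summit.QuantumFields.YangMills.Theorems.TransportPerturbation

/-! ## §1 Elementary tools -/

section Elementary

/-- AM–GM in the form `√z ≤ z/(2s) + s/2` for `s > 0` (from `(√z − s)² ≥ 0`). [folklore] -/
theorem sqrt_le_div_add {z : ℝ} (hz : 0 ≤ z) {s : ℝ} (hs : 0 < s) : Real.sqrt z ≤ z / (2 * s) + s / 2 := by
  have hsq : Real.sqrt z * Real.sqrt z = z := Real.mul_self_sqrt hz
  have h0 : 0 ≤ (Real.sqrt z - s) ^ 2 := sq_nonneg _
  have h2s : 0 < 2 * s := by positivity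
  rw [div_add_div _ _ h2s.ne' two_ne_zero, le_div_iff₀ (by positivity)]
  nlinarith [Real.sqrt_nonneg z]

/-- An affine integrand `ω ↦ c + k·f ω` of an integrable `f` on a probability space is integrable with integral
`c + k·∫f`. [folklore] -/
theorem integral_affine {Ω₀ : Type*} [MeasurableSpace Ω₀] (P₀ : Measure Ω₀) [IsProbabilityMeasure P₀] {f : Ω₀ → ℝ}
    (hf : Integrable f P₀) (c k : ℝ) :
    Integrable (fun ω => c + k * f ω) P₀ ∧ ∫ ω, (c + k * f ω) ∂P₀ = c + k * ∫ ω, f ω ∂P₀ :=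
  ⟨(integrable_const c).add (hf.const_mul k), by
    rw [integral_add (integrable_const c) (hf.const_mul k), integral_const, probReal_univ, one_smul, integral_const_mul]⟩

variable {C Ω : Type*} [MeasurableSpace Ω]

/-- The transition operator of a family jointly measurable at time `t` maps measurable functions to measurable functions
(Fubini measurability of `x ↦ ∫ g(V x t ω) dP`). [folklore] -/
theorem measurable_markovTransition [MeasurableSpace C] {V : C → ℝ≥0 → Ω → C} {t : ℝ≥0}
    (hV : Measurable fun p : C × Ω => V p.1 t p.2) (P : Measure Ω) [SFinite P] {g : C → ℝ} (hg : Measurable g) :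
    Measurable (markovTransition V P t g) := by
  have h : StronglyMeasurable (fun p : C × Ω => g (V p.1 t p.2)) := (hg.comp hV).stronglyMeasurable
  exact h.integral_prod_right'.measurable

/-- For a fixed start, `ω ↦ V x t ω` is measurable (a section of the jointly measurable map). [folklore] -/
theorem measurable_section [MeasurableSpace C] {V : C → ℝ≥0 → Ω → C} {t : ℝ≥0}
    (hV : Measurable fun p : C × Ω => V p.1 t p.2) (x : C) : Measurable fun ω => V x t ω :=
  hV.comp measurable_prodMk_left

/-- `|P_t g| ≤ 1` when `|g| ≤ 1` (probability measure; junk value `0` included). [folklore] -/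
theorem abs_markovTransition_le_one (V : C → ℝ≥0 → Ω → C) (P : Measure Ω) [IsProbabilityMeasure P] (t : ℝ≥0)
    {g : C → ℝ} (hg : ∀ u, |g u| ≤ 1) (x : C) : |markovTransition V P t g x| ≤ 1 := by
  unfold markovTransition
  have h := norm_integral_le_of_norm_le_const (μ := P) (f := fun ω => g (V x t ω)) (C := 1)
    (ae_of_all _ fun ω => by rw [Real.norm_eq_abs]; exact hg _)
  rwa [Real.norm_eq_abs, probReal_univ, mul_one] at h

/-- `0 ≤ P_t Λ` when `0 ≤ Λ`. [folklore] -/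
theorem markovTransition_nonneg_of_nonneg (V : C → ℝ≥0 → Ω → C) (P : Measure Ω) (t : ℝ≥0) {Λ : C → ℝ} (hΛ : ∀ u, 0 ≤ Λ u)
    (x : C) : 0 ≤ markovTransition V P t Λ x :=
  integral_nonneg fun _ => hΛ _

/-- `P_t Λ ≤ M` when `Λ ≤ M` and `0 ≤ M` (probability measure). [folklore] -/
theorem markovTransition_le (V : C → ℝ≥0 → Ω → C) (P : Measure Ω) [IsProbabilityMeasure P] (t : ℝ≥0) {Λ : C → ℝ}
    {M : ℝ} (hΛ0 : ∀ u, 0 ≤ Λ u) (hΛM : ∀ u, Λ u ≤ M) (x : C) : markovTransition V P t Λ x ≤ M := by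
  unfold markovTransition
  have hM : 0 ≤ M := (hΛ0 x).trans (hΛM x)
  have h := norm_integral_le_of_norm_le_const (μ := P) (f := fun ω => Λ (V x t ω)) (C := M)
    (ae_of_all _ fun ω => by rw [Real.norm_eq_abs, abs_of_nonneg (hΛ0 _)]; exact hΛM _)
  rw [Real.norm_eq_abs, probReal_univ, mul_one] at h
  exact (le_abs_self _).trans h

/-- `P_t (Λ / M) = (P_t Λ) / M` (unconditional linearity of the Bochner integral in constants). [folklore] -/
theorem markovTransition_div_const (V : C → ℝ≥0 → Ω → C) (P : Measure Ω) (t : ℝ≥0) (Λ : C → ℝ) (M : ℝ) (x : C) :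
    markovTransition V P t (fun u => Λ u / M) x = markovTransition V P t Λ x / M := by
  unfold markovTransition
  exact integral_div M _

end Elementary

/-! ## §2 The two-space oscillation bound -/

section Oscillation

variable {C Ω Ω' : Type*} [MeasurableSpace C] [MeasurableSpace Ω] [MeasurableSpace Ω']

/-- **Two-space oscillation bound** (Jensen-free): if `|g u − g v| ≤ 2A √(1 + Λ u + Λ v)` for all `u, v` with `0 ≤ Λ ≤ M`
measurable and `|g| ≤ 1` measurable, then for measurable `y₁ : Ω' → C`, `y₂ : Ω → C` under probability measures,
`|E' g(y₁) − E g(y₂)| ≤ 2A √(1 + E' Λ(y₁) + E Λ(y₂))`. [cite: HairerMattinglyScheutzow2011, §4 (distance-like function d̃)] -/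
theorem abs_integral_sub_integral_le (P : Measure Ω) (P' : Measure Ω') [IsProbabilityMeasure P] [IsProbabilityMeasure P']
    {y₁ : Ω' → C} {y₂ : Ω → C} (hy₁ : Measurable y₁) (hy₂ : Measurable y₂)
    {Λ g : C → ℝ} (hΛm : Measurable Λ) (hΛ0 : ∀ u, 0 ≤ Λ u) {M : ℝ} (hΛM : ∀ u, Λ u ≤ M)
    (hgm : Measurable g) (hg1 : ∀ u, |g u| ≤ 1) {A : ℝ} (hA : 0 ≤ A)
    (hlip : ∀ u v, |g u - g v| ≤ 2 * A * Real.sqrt (1 + Λ u + Λ v)) :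
    |(∫ ω', g (y₁ ω') ∂P') - ∫ ω, g (y₂ ω) ∂P| ≤
      2 * A * Real.sqrt (1 + (∫ ω', Λ (y₁ ω') ∂P') + ∫ ω, Λ (y₂ ω) ∂P) := by
  set a : ℝ := ∫ ω', Λ (y₁ ω') ∂P' with ha
  set b : ℝ := ∫ ω, Λ (y₂ ω) ∂P with hb
  have ha0 : 0 ≤ a := integral_nonneg fun _ => hΛ0 _
  have hb0 : 0 ≤ b := integral_nonneg fun _ => hΛ0 _
  set s : ℝ := Real.sqrt (1 + a + b) with hs
  have hs0 : 0 < s := Real.sqrt_pos.2 (by linarith)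
  -- integrability bookkeeping
  have hiΛ1 : Integrable (fun ω' => Λ (y₁ ω')) P' :=
    (integrable_const M).mono' (hΛm.comp hy₁).aestronglyMeasurable
      (ae_of_all _ fun ω' => by rw [Real.norm_eq_abs, abs_of_nonneg (hΛ0 _)]; exact hΛM _)
  have hiΛ2 : Integrable (fun ω => Λ (y₂ ω)) P :=
    (integrable_const M).mono' (hΛm.comp hy₂).aestronglyMeasurable
      (ae_of_all _ fun ω => by rw [Real.norm_eq_abs, abs_of_nonneg (hΛ0 _)]; exact hΛM _)
  have hig1 : Integrable (fun ω' => g (y₁ ω')) P' :=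
    (integrable_const (1 : ℝ)).mono' (hgm.comp hy₁).aestronglyMeasurable
      (ae_of_all _ fun ω' => by rw [Real.norm_eq_abs]; exact hg1 _)
  have hig2 : Integrable (fun ω => g (y₂ ω)) P :=
    (integrable_const (1 : ℝ)).mono' (hgm.comp hy₂).aestronglyMeasurable
      (ae_of_all _ fun ω => by rw [Real.norm_eq_abs]; exact hg1 _)
  -- the AM–GM majorant of the modulus
  have hmaj : ∀ u v, |g u - g v| ≤ 2 * A * ((1 + Λ u + Λ v) / (2 * s) + s / 2) := fun u v =>
    (hlip u v).trans (mul_le_mul_of_nonneg_left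
      (sqrt_le_div_add (by linarith [hΛ0 u, hΛ0 v]) hs0) (by positivity))
  -- inner step: for every `ω'`, `|g(y₁ ω') − E g(y₂)| ≤ 2A((1 + Λ(y₁ ω') + b)/(2s) + s/2)`
  have hinner : ∀ ω', |g (y₁ ω') - ∫ ω, g (y₂ ω) ∂P| ≤ 2 * A * ((1 + Λ (y₁ ω') + b) / (2 * s) + s / 2) := by
    intro ω'
    have hrepr : g (y₁ ω') - ∫ ω, g (y₂ ω) ∂P = ∫ ω, (g (y₁ ω') - g (y₂ ω)) ∂P := by
      rw [integral_sub (integrable_const _) hig2, integral_const, probReal_univ, one_smul]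
    have hform : (fun ω => 2 * A * ((1 + Λ (y₁ ω') + Λ (y₂ ω)) / (2 * s) + s / 2)) =
        fun ω => (2 * A * ((1 + Λ (y₁ ω')) / (2 * s) + s / 2)) + (2 * A / (2 * s)) * Λ (y₂ ω) := by
      funext ω; ring
    obtain ⟨hint, hval⟩ := integral_affine P hiΛ2 (2 * A * ((1 + Λ (y₁ ω')) / (2 * s) + s / 2)) (2 * A / (2 * s))
    rw [hrepr]
    calc |∫ ω, (g (y₁ ω') - g (y₂ ω)) ∂P| ≤ ∫ ω, |g (y₁ ω') - g (y₂ ω)| ∂P := abs_integral_le_integral_abs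
      _ ≤ ∫ ω, 2 * A * ((1 + Λ (y₁ ω') + Λ (y₂ ω)) / (2 * s) + s / 2) ∂P :=
          integral_mono_of_nonneg (ae_of_all _ fun ω => abs_nonneg _) (hform ▸ hint) (ae_of_all _ fun ω => hmaj _ _)
      _ = 2 * A * ((1 + Λ (y₁ ω') + b) / (2 * s) + s / 2) := by rw [hform, hval, ← hb]; ring
  -- outer step
  have hrepr' : (∫ ω', g (y₁ ω') ∂P') - ∫ ω, g (y₂ ω) ∂P = ∫ ω', (g (y₁ ω') - ∫ ω, g (y₂ ω) ∂P) ∂P' := by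
    rw [integral_sub hig1 (integrable_const _), integral_const, probReal_univ, one_smul]
  have hform' : (fun ω' => 2 * A * ((1 + Λ (y₁ ω') + b) / (2 * s) + s / 2)) =
      fun ω' => (2 * A * ((1 + b) / (2 * s) + s / 2)) + (2 * A / (2 * s)) * Λ (y₁ ω') := by
    funext ω'; ring
  obtain ⟨hint', hval'⟩ := integral_affine P' hiΛ1 (2 * A * ((1 + b) / (2 * s) + s / 2)) (2 * A / (2 * s))
  rw [hrepr']
  calc |∫ ω', (g (y₁ ω') - ∫ ω, g (y₂ ω) ∂P) ∂P'| ≤ ∫ ω', |g (y₁ ω') - ∫ ω, g (y₂ ω) ∂P| ∂P' :=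
        abs_integral_le_integral_abs
    _ ≤ ∫ ω', 2 * A * ((1 + Λ (y₁ ω') + b) / (2 * s) + s / 2) ∂P' :=
        integral_mono_of_nonneg (ae_of_all _ fun ω' => abs_nonneg _) (hform' ▸ hint') (ae_of_all _ fun ω' => hinner ω')
    _ = 2 * A * ((1 + a + b) / (2 * s) + s / 2) := by rw [hform', hval', ← ha]; ring
    _ = 2 * A * s := by
        have hss : s * s = 1 + a + b := by rw [hs]; exact Real.mul_self_sqrt (by linarith)
        have : (1 + a + b) / (2 * s) + s / 2 = s := by
          rw [← hss]; field_simp; ring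
        rw [this]

end Oscillation

/-! ## §3 The abstract averaging lemma -/

section Abstract

variable {C X Xc Ω Ω' : Type*} [MeasurableSpace C] [MeasurableSpace X] [MeasurableSpace Xc]
  [MeasurableSpace Ω] [MeasurableSpace Ω']

/-- **The averaging step, abstract form** (the content of `ShadowAveraging` over ANY configuration space with a transport
weight `S ≤ 4` that separates one pair, `S(u₀,v₀) > 0`): mass of the irregular set `≤ e`, pointwise shadowing on the regular set, and the
window identity give `|∫ g∘D dμ − ∫ (P_t g)∘D dμ| ≤ A·(ρ + 2√e)·(1 + ∫ Λ∘D dμ + ∫ (P_t Λ)∘D dμ)` on the weighted class.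
[cite: HairerMattinglyScheutzow2011, §4 (distance-like function d̃)] [cite: RudolfSchweizer2018, Thm 3.1] -/
theorem shadowAveraging_abstract (S : C → C → ℝ) (hS4 : ∀ u v, S u v ≤ 4)
    (hSsep : ∃ u v, 0 < S u v)
    (μ : Measure X) (P : Measure Ω) (P' : Measure Ω') [IsProbabilityMeasure μ] [IsProbabilityMeasure P]
    [IsProbabilityMeasure P']
    (V : C → ℝ≥0 → Ω → C) (t : ℝ≥0) (V' : Xc → ℝ≥0 → Ω' → Xc) (t' : ℝ≥0) (E : X → Xc) (Dc : Xc → C) (D : X → C)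
    (R : X → Prop) (e ρ : ℝ)
    (hV : Measurable fun p : C × Ω => V p.1 t p.2) (hV' : Measurable fun p : Xc × Ω' => V' p.1 t' p.2)
    (hE : Measurable E) (hDc : Measurable Dc) (hD : Measurable D) (hR : MeasurableSet {x | R x})
    (he : 0 ≤ e) (hρ : 0 ≤ ρ) (hmass : μ.real {x | ¬ R x} ≤ e)
    (hpt : ∀ x, R x → ∀ (Λ : C → ℝ), Measurable Λ → (∀ u, 0 ≤ Λ u) → (∃ M : ℝ, ∀ u, Λ u ≤ M) →
      ∀ (A : ℝ) (g : C → ℝ), (Measurable g ∧ (∀ u, |g u| ≤ 1) ∧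
        ∀ u v, |g u - g v| ≤ A * Real.sqrt (S u v * (1 + Λ u + Λ v))) →
        |markovTransition V' P' t' (g ∘ Dc) (E x) - markovTransition V P t g (D x)| ≤
          A * (ρ * Real.sqrt (1 + markovTransition V' P' t' (Λ ∘ Dc) (E x) + markovTransition V P t Λ (D x))))
    (hwin : ∀ g : C → ℝ, Measurable g → (∀ u, |g u| ≤ 1) →
      (∫ x, g (D x) ∂μ) = ∫ x, markovTransition V' P' t' (g ∘ Dc) (E x) ∂μ)
    (Λ : C → ℝ) (hΛm : Measurable Λ) (hΛ0 : ∀ u, 0 ≤ Λ u) (hΛM : ∃ M : ℝ, ∀ u, Λ u ≤ M) (A : ℝ) (g : C → ℝ)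
    (hg : Measurable g ∧ (∀ u, |g u| ≤ 1) ∧ ∀ u v, |g u - g v| ≤ A * Real.sqrt (S u v * (1 + Λ u + Λ v))) :
    |(∫ x, g (D x) ∂μ) - ∫ x, markovTransition V P t g (D x) ∂μ| ≤
      A * ((ρ + 2 * Real.sqrt e) * (1 + (∫ x, Λ (D x) ∂μ) + ∫ x, markovTransition V P t Λ (D x) ∂μ)) := by
  obtain ⟨hgm, hg1, hglip⟩ := hg
  obtain ⟨M, hM⟩ := hΛM
  -- the corner `A < 0` is vacuous: the class is empty at the separating pair
  rcases lt_or_ge A 0 with hA | hA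
  · exfalso
    obtain ⟨u₀, v₀, huv⟩ := hSsep
    have h1 : 0 < Real.sqrt (S u₀ v₀ * (1 + Λ u₀ + Λ v₀)) :=
      Real.sqrt_pos.2 (mul_pos huv (by linarith [hΛ0 u₀, hΛ0 v₀]))
    have h2 := hglip u₀ v₀
    have h3 : A * Real.sqrt (S u₀ v₀ * (1 + Λ u₀ + Λ v₀)) < 0 := mul_neg_of_neg_of_pos hA h1
    linarith [abs_nonneg (g u₀ - g v₀)]
  -- the pointwise clause at our `Λ`, `A`, `g`
  have hptx : ∀ x, R x → |markovTransition V' P' t' (g ∘ Dc) (E x) - markovTransition V P t g (D x)| ≤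
      A * (ρ * Real.sqrt (1 + markovTransition V' P' t' (Λ ∘ Dc) (E x) + markovTransition V P t Λ (D x))) :=
    fun x hx => hpt x hx Λ hΛm hΛ0 ⟨M, hM⟩ A g ⟨hgm, hg1, hglip⟩
  -- `∫ ΦΛ dμ = ∫ Λ∘D dμ` from the window identity for `Λ / max M 1`
  have hIa : (∫ x, markovTransition V' P' t' (Λ ∘ Dc) (E x) ∂μ) = ∫ x, Λ (D x) ∂μ := by
    set M' : ℝ := max M 1 with hM'
    have hM'0 : 0 < M' := lt_of_lt_of_le one_pos (le_max_right _ _)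
    have hw := hwin (fun u => Λ u / M') (hΛm.div_const _) (fun u => by
      rw [abs_of_nonneg (div_nonneg (hΛ0 u) hM'0.le), div_le_one hM'0]; exact (hM u).trans (le_max_left _ _))
    have hl : (∫ x, (fun u => Λ u / M') (D x) ∂μ) = (∫ x, Λ (D x) ∂μ) / M' := integral_div _ _
    have hr : (∫ x, markovTransition V' P' t' ((fun u => Λ u / M') ∘ Dc) (E x) ∂μ) =
        (∫ x, markovTransition V' P' t' (Λ ∘ Dc) (E x) ∂μ) / M' := by
      have : (fun x => markovTransition V' P' t' ((fun u => Λ u / M') ∘ Dc) (E x)) =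
          fun x => markovTransition V' P' t' (Λ ∘ Dc) (E x) / M' := by
        funext x
        exact markovTransition_div_const V' P' t' (Λ ∘ Dc) M' (E x)
      rw [this, integral_div]
    rw [hl, hr] at hw
    exact ((div_left_inj' hM'0.ne').1 hw).symm
  -- window identity
  rw [hwin g hgm hg1, ← hIa]
  -- notation
  set Φg : X → ℝ := fun x => markovTransition V' P' t' (g ∘ Dc) (E x) with hΦg
  set Ψg : X → ℝ := fun x => markovTransition V P t g (D x) with hΨg
  set a : X → ℝ := fun x => markovTransition V' P' t' (Λ ∘ Dc) (E x) with ha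
  set b : X → ℝ := fun x => markovTransition V P t Λ (D x) with hb
  -- measurability and bounds
  have hΦgm : Measurable Φg := (measurable_markovTransition hV' P' (hgm.comp hDc)).comp hE
  have hΨgm : Measurable Ψg := (measurable_markovTransition hV P hgm).comp hD
  have ham : Measurable a := (measurable_markovTransition hV' P' (hΛm.comp hDc)).comp hE
  have hbm : Measurable b := (measurable_markovTransition hV P hΛm).comp hD
  have hΦg1 : ∀ x, |Φg x| ≤ 1 := fun x => abs_markovTransition_le_one V' P' t' (g := g ∘ Dc) (fun u => hg1 _) _
  have hΨg1 : ∀ x, |Ψg x| ≤ 1 := fun x => abs_markovTransition_le_one V P t hg1 _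
  have ha0 : ∀ x, 0 ≤ a x := fun x => markovTransition_nonneg_of_nonneg V' P' t' (Λ := Λ ∘ Dc) (fun u => hΛ0 _) _
  have hb0 : ∀ x, 0 ≤ b x := fun x => markovTransition_nonneg_of_nonneg V P t hΛ0 _
  have haM : ∀ x, a x ≤ M := fun x => markovTransition_le V' P' t' (Λ := Λ ∘ Dc) (fun u => hΛ0 _) (fun u => hM _) _
  have hbM : ∀ x, b x ≤ M := fun x => markovTransition_le V P t hΛ0 hM _
  have hint : ∀ {f : X → ℝ}, Measurable f → ∀ K : ℝ, (∀ x, |f x| ≤ K) → Integrable f μ := fun hf K hK =>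
    (integrable_const K).mono' hf.aestronglyMeasurable (ae_of_all _ fun x => by rw [Real.norm_eq_abs]; exact hK x)
  have hiΦg : Integrable Φg μ := hint hΦgm 1 hΦg1
  have hiΨg : Integrable Ψg μ := hint hΨgm 1 hΨg1
  have hia : Integrable a μ := hint ham M (fun x => by rw [abs_of_nonneg (ha0 x)]; exact haM x)
  have hib : Integrable b μ := hint hbm M (fun x => by rw [abs_of_nonneg (hb0 x)]; exact hbM x)
  -- `Z = 1 + a + b ≥ 1`, `I = ∫ Z = 1 + Ia + Ib ≥ 1`
  set Ia : ℝ := ∫ x, a x ∂μ with hIadef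
  set Ib : ℝ := ∫ x, b x ∂μ with hIbdef
  have hIa0 : 0 ≤ Ia := integral_nonneg ha0
  have hIb0 : 0 ≤ Ib := integral_nonneg hb0
  have hZ1 : ∀ x, 1 ≤ 1 + a x + b x := fun x => by linarith [ha0 x, hb0 x]
  have hZint : Integrable (fun x => 1 + a x + b x) μ := ((integrable_const 1).add hia).add hib
  have hi1a : Integrable (fun x => (1 : ℝ) + a x) μ := (integrable_const 1).add hia
  have hZI : ∫ x, (1 + a x + b x) ∂μ = 1 + Ia + Ib := by
    rw [integral_add hi1a hib, integral_add (integrable_const (1 : ℝ)) hia, integral_const, probReal_univ, one_smul]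
  have hI1 : 1 ≤ 1 + Ia + Ib := by linarith
  have hsqZm : Measurable fun x => Real.sqrt (1 + a x + b x) := ((measurable_const.add ham).add hbm).sqrt
  have hsqZint : Integrable (fun x => Real.sqrt (1 + a x + b x)) μ :=
    hZint.mono' hsqZm.aestronglyMeasurable (ae_of_all _ fun x => by
      rw [Real.norm_eq_abs, abs_of_nonneg (Real.sqrt_nonneg _)]; exact Real.sqrt_le_self_iff.2 (Or.inr (hZ1 x)))
  -- (i) `∫ √Z ≤ I`
  have hsqrt_le : ∫ x, Real.sqrt (1 + a x + b x) ∂μ ≤ 1 + Ia + Ib := by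
    rw [← hZI]
    exact integral_mono hsqZint hZint fun x => Real.sqrt_le_self_iff.2 (Or.inr (hZ1 x))
  -- (ii) `∫ 1_{¬R} √Z ≤ √e · I` (AM–GM form of Cauchy–Schwarz)
  have hRc : MeasurableSet {x | ¬ R x} := hR.compl
  set χ : X → ℝ := {x | ¬ R x}.indicator 1 with hχ
  have hχm : Measurable χ := measurable_one.indicator hRc
  have hχ01 : ∀ x, 0 ≤ χ x ∧ χ x ≤ 1 := fun x => by
    by_cases hx : x ∈ {x | ¬ R x}
    · rw [hχ, Set.indicator_of_mem hx]; simp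
    · rw [hχ, Set.indicator_of_notMem hx]; simp
  have hχint : Integrable χ μ := hint hχm 1 (fun x => by rw [abs_of_nonneg (hχ01 x).1]; exact (hχ01 x).2)
  have hχI : ∫ x, χ x ∂μ = μ.real {x | ¬ R x} := integral_indicator_one hRc
  have hχsqm : Measurable fun x => χ x * Real.sqrt (1 + a x + b x) := hχm.mul hsqZm
  have hχsqint : Integrable (fun x => χ x * Real.sqrt (1 + a x + b x)) μ :=
    hsqZint.mono' hχsqm.aestronglyMeasurable (ae_of_all _ fun x => by
      rw [Real.norm_eq_abs, abs_of_nonneg (mul_nonneg (hχ01 x).1 (Real.sqrt_nonneg _))]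
      calc χ x * Real.sqrt (1 + a x + b x) ≤ 1 * Real.sqrt (1 + a x + b x) :=
            mul_le_mul_of_nonneg_right (hχ01 x).2 (Real.sqrt_nonneg _)
        _ = Real.sqrt (1 + a x + b x) := one_mul _)
  have hCS : ∫ x, χ x * Real.sqrt (1 + a x + b x) ∂μ ≤ Real.sqrt e * (1 + Ia + Ib) := by
    -- AM–GM for every `s > 0`
    have hs : ∀ s : ℝ, 0 < s → ∫ x, χ x * Real.sqrt (1 + a x + b x) ∂μ ≤ (1 + Ia + Ib) / (2 * s) + s / 2 * e := by
      intro s hs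
      have hmaj : ∀ x, χ x * Real.sqrt (1 + a x + b x) ≤ (1 + a x + b x) / (2 * s) + s / 2 * χ x := fun x => by
        have h1 := sqrt_le_div_add (le_trans zero_le_one (hZ1 x)) hs
        have hZ0 : 0 ≤ (1 + a x + b x) / (2 * s) := div_nonneg (le_trans zero_le_one (hZ1 x)) (by positivity)
        calc χ x * Real.sqrt (1 + a x + b x) ≤ χ x * ((1 + a x + b x) / (2 * s) + s / 2) :=
              mul_le_mul_of_nonneg_left h1 (hχ01 x).1
          _ = χ x * ((1 + a x + b x) / (2 * s)) + s / 2 * χ x := by ring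
          _ ≤ 1 * ((1 + a x + b x) / (2 * s)) + s / 2 * χ x :=
              add_le_add (mul_le_mul_of_nonneg_right (hχ01 x).2 hZ0) le_rfl
          _ = (1 + a x + b x) / (2 * s) + s / 2 * χ x := by rw [one_mul]
      have hint2 : Integrable (fun x => (1 + a x + b x) / (2 * s) + s / 2 * χ x) μ :=
        (hZint.div_const _).add (hχint.const_mul _)
      calc ∫ x, χ x * Real.sqrt (1 + a x + b x) ∂μ ≤ ∫ x, ((1 + a x + b x) / (2 * s) + s / 2 * χ x) ∂μ :=
            integral_mono hχsqint hint2 hmaj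
        _ = (1 + Ia + Ib) / (2 * s) + s / 2 * μ.real {x | ¬ R x} := by
            rw [integral_add (hZint.div_const _) (hχint.const_mul _), integral_div, hZI, integral_const_mul, hχI]
        _ ≤ (1 + Ia + Ib) / (2 * s) + s / 2 * e :=
            add_le_add le_rfl (mul_le_mul_of_nonneg_left hmass (by positivity : (0 : ℝ) ≤ s / 2))
    rcases eq_or_lt_of_le he with he0 | he0
    · -- `e = 0`: the irregular set is null, the integral vanishes
      rw [← he0, Real.sqrt_zero, zero_mul]
      have hnull : μ {x | ¬ R x} = 0 := by
        have h0 : μ.real {x | ¬ R x} ≤ 0 := by rw [he0]; exact hmass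
        exact (measureReal_eq_zero_iff (measure_ne_top μ _)).1 (le_antisymm h0 measureReal_nonneg)
      have hae : (fun x => χ x * Real.sqrt (1 + a x + b x)) =ᵐ[μ] fun _ => (0 : ℝ) := by
        have : ∀ᵐ x ∂μ, x ∉ {x | ¬ R x} := measure_eq_zero_iff_ae_notMem.1 hnull
        filter_upwards [this] with x hx
        rw [hχ, Set.indicator_of_notMem hx, zero_mul]
      rw [integral_congr_ae hae, integral_zero]
    · -- `e > 0`: optimise `s = √I / √e`
      set I : ℝ := 1 + Ia + Ib with hIdef
      have hI0 : 0 < I := lt_of_lt_of_le one_pos hI1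
      have hsI : 0 < Real.sqrt I := Real.sqrt_pos.2 hI0
      have hse : 0 < Real.sqrt e := Real.sqrt_pos.2 he0
      have h := hs (Real.sqrt I / Real.sqrt e) (div_pos hsI hse)
      have hII : Real.sqrt I * Real.sqrt I = I := Real.mul_self_sqrt hI0.le
      have hee : Real.sqrt e * Real.sqrt e = e := Real.mul_self_sqrt he0.le
      have hval : I / (2 * (Real.sqrt I / Real.sqrt e)) + Real.sqrt I / Real.sqrt e / 2 * e =
          Real.sqrt e * Real.sqrt I := by
        field_simp
        nlinarith [hII, hee]
      rw [hval] at h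
      calc ∫ x, χ x * Real.sqrt (1 + a x + b x) ∂μ ≤ Real.sqrt e * Real.sqrt I := h
        _ ≤ Real.sqrt e * I := mul_le_mul_of_nonneg_left (Real.sqrt_le_self_iff.2 (Or.inr hI1)) hse.le
  -- (iii) the pointwise bound everywhere, with the indicator
  have hlip2 : ∀ u v, |g u - g v| ≤ 2 * A * Real.sqrt (1 + Λ u + Λ v) := fun u v => by
    have hZ : 0 ≤ 1 + Λ u + Λ v := by linarith [hΛ0 u, hΛ0 v]
    calc |g u - g v| ≤ A * Real.sqrt (S u v * (1 + Λ u + Λ v)) := hglip u v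
      _ ≤ A * Real.sqrt (4 * (1 + Λ u + Λ v)) :=
          mul_le_mul_of_nonneg_left (Real.sqrt_le_sqrt (mul_le_mul_of_nonneg_right (hS4 u v) hZ)) hA
      _ = 2 * A * Real.sqrt (1 + Λ u + Λ v) := by
          rw [Real.sqrt_mul (by norm_num : (0:ℝ) ≤ 4), show Real.sqrt 4 = 2 by
            rw [show (4:ℝ) = 2 * 2 by norm_num]; exact Real.sqrt_mul_self zero_le_two]
          ring
  have hpw : ∀ x, |Φg x - Ψg x| ≤ (A * ρ + 2 * A * χ x) * Real.sqrt (1 + a x + b x) := by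
    intro x
    by_cases hx : R x
    · have hχx : χ x = 0 := by rw [hχ]; exact Set.indicator_of_notMem (by simpa using hx) _
      rw [hχx, mul_zero, add_zero]
      have := hptx x hx
      simpa only [hΦg, hΨg, ha, hb, mul_assoc] using this
    · have hχx : χ x = 1 := by rw [hχ, Set.indicator_of_mem (by simpa using hx)]; rfl
      rw [hχx, mul_one]
      have hosc := abs_integral_sub_integral_le (C := C) P P'
        (y₁ := fun ω' => Dc (V' (E x) t' ω')) (y₂ := fun ω => V (D x) t ω)
        (hDc.comp (measurable_section hV' (E x))) (measurable_section hV (D x))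
        hΛm hΛ0 hM hgm hg1 hA hlip2
      calc |Φg x - Ψg x| ≤ 2 * A * Real.sqrt (1 + a x + b x) := hosc
        _ ≤ (A * ρ + 2 * A) * Real.sqrt (1 + a x + b x) :=
            mul_le_mul_of_nonneg_right (by nlinarith) (Real.sqrt_nonneg _)
  -- (iv) integrate
  have hform : (fun x => (A * ρ + 2 * A * χ x) * Real.sqrt (1 + a x + b x)) =
      fun x => (A * ρ) * Real.sqrt (1 + a x + b x) + (2 * A) * (χ x * Real.sqrt (1 + a x + b x)) := by
    funext x; ring
  have hmajint : Integrable (fun x => (A * ρ + 2 * A * χ x) * Real.sqrt (1 + a x + b x)) μ :=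
    hform ▸ (hsqZint.const_mul _).add (hχsqint.const_mul _)
  have hdiff : (∫ x, Φg x ∂μ) - ∫ x, Ψg x ∂μ = ∫ x, (Φg x - Ψg x) ∂μ := (integral_sub hiΦg hiΨg).symm
  calc |(∫ x, Φg x ∂μ) - ∫ x, Ψg x ∂μ| = |∫ x, (Φg x - Ψg x) ∂μ| := by rw [hdiff]
    _ ≤ ∫ x, |Φg x - Ψg x| ∂μ := abs_integral_le_integral_abs
    _ ≤ ∫ x, (A * ρ + 2 * A * χ x) * Real.sqrt (1 + a x + b x) ∂μ :=
        integral_mono_of_nonneg (ae_of_all _ fun x => abs_nonneg _) hmajint (ae_of_all _ hpw)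
    _ = (A * ρ) * ∫ x, Real.sqrt (1 + a x + b x) ∂μ + (2 * A) * ∫ x, χ x * Real.sqrt (1 + a x + b x) ∂μ := by
        rw [hform, integral_add (hsqZint.const_mul _) (hχsqint.const_mul _), integral_const_mul, integral_const_mul]
    _ ≤ (A * ρ) * (1 + Ia + Ib) + (2 * A) * (Real.sqrt e * (1 + Ia + Ib)) :=
        add_le_add (mul_le_mul_of_nonneg_left hsqrt_le (mul_nonneg hA hρ))
          (mul_le_mul_of_nonneg_left hCS (by positivity))
    _ = A * ((ρ + 2 * Real.sqrt e) * (1 + Ia + Ib)) := by ring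

end Abstract

end Summit.QuantumFields.YangMills.Theorems.TransportPerturbation

end
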